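import Literature.NumberTheory.EllipticCurves.ShaRestriction
import HarnessLib

/-!
# Route `SylvesterTwoHeegnerIndex` (rung K7t), crux `HeegnerIndexUpperAtTwoHSY` (item 19229), layer 2:
# the DESCENT STEP AT `p = 2` of the Kolyvagin road — `Ш(E/K) → Ш(E/L)` is INJECTIVE along a quadratic
# extension whose anti-invariant points are odd torsion (the `p`-odd step «`Ш(E/K′)[p^∞] ⊇ Ш(E/ℚ)[p^∞]`»
# has an exact substitute at `2` for the Sylvester curves)

HONEST FRAMING (cell «bsd-cm», `run/shared/lean/pub/bsd-cm/`, D-0033 tranche 1a; D-0074 seat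
`bsd-cm-k7t-c2`, item stmt-BirchSwinnertonDyer-19229): the crux is the Euler-system (Kolyvagin) half of
`BSD(E_p, 2)` on 𝒞_HSY and stays OPEN. In the route's currency a Kolyvagin argument runs over a Heegner
field `K′` and must DESCEND from `Ш(E_p/K′)` to `Ш(E_p/ℚ)`; at an ODD prime the descent costs nothing
(`[K′ : ℚ] = 2` is prime to `p`), at `p = 2` it can lose a power of `2` in general (the kernel of
`H¹(ℚ, E) → H¹(K′, E)` is `H¹(Gal(K′/ℚ), E(K′))`, a `2`-group). This file proves, sorry-free and in
the tree's Galois-cohomology currency (`Literature/…/ShaRestriction.lean`: `Ш = WeierstrassCurve.sha`,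
restriction `shaRestriction`, inflation `inflClass`), the criterion that makes the `p = 2` descent CLEAN:

* `inflClass_eq_zero_of_index_two` — for an open normal subgroup `N ≤ G` of index `2` and a crossed
  homomorphism `f : G → M` vanishing on `N`, if every `N`-invariant `a ∈ M` on which `G ∖ N` acts by
  `−1` is killed by an ODD integer, then `[f] = 0` in `H¹_cont(G, M)` (`f = ∂(j•a)` with `2j+1` killing
  `a = f(g₀)`): `H¹(C₂, M^N)` has no odd part and its `2`-part is carried by the anti-invariants.
* `shaRestriction_injective_of_index_two` — hence for a number field extension `L/K` with
  `[L̃ : K] = 2` (`L̃` the Galois closure in `K̄`): if every `L̃`-point of `E` on which the non-trivial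
  automorphism acts by `−1` is odd torsion, then `Ш(E/K) → Ш(E_L/L)` is INJECTIVE (no `2`-power lost).

For `E = E_p` (`x³ + y³ = p`) and a Heegner field `K′`: `E_p(K′)[2] = 0` (no `∛(4p²)` in a quadratic
field) and the anti-invariant points are `E_p^{(d_{K′})}(ℚ)`, finite (rank-zero twin, Burungale–Flach /
Gross–Zagier–Kolyvagin) of odd order — so the hypothesis holds there and `ord₂ #Ш(E_p/ℚ) ≤ ord₂ #Ш(E_p/K′)`;
that instantiation (Galois descent `E(K̄)^{Γ_{K′}} = E(K′)` + the twist identification) is NOT done in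
this file and is recorded as the next typed step. WHAT THIS IS NOT: not a Kolyvagin bound, not the crux;
nothing about the class 𝒞_HSY is asserted; nothing booked.
References: [SerreGaloisCohomology1997] I.§2.4, I.§5.8 (inflation–restriction); [SilvermanAEC2009] X.§4
(Prop. 4.2), App. B; [Darmon2004] §3.9 and Exercise 3.18; [GrossLMS1991] §2 (descent over the Heegner field,
`p` odd); parent `Literature/NumberTheory/EllipticCurves/ShaRestriction.lean`.
-/

set_option autoImplicit false
set_option linter.dupNamespace false

noncomputable section

open scoped Classical Pointwise

universe u

open Literature.NumberTheory.EllipticCurves Literature.NumberTheory.GaloisRepresentations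

namespace Summit.BirchSwinnertonDyer.BirchSwinnertonDyer.Theorems.SylvesterTwoUpper

/-! ## §1 Index two: inflated classes die when the anti-invariants are odd torsion -/

section IndexTwo

variable {G : Type u} [Group G] [TopologicalSpace G] [IsTopologicalGroup G]
variable {M : Type u} [AddCommGroup M] [DistribMulAction G M] [TopologicalSpace M]
  [DiscreteTopology M]

/-- **`H¹(C₂, M^N)` vanishes on odd-torsion anti-invariants.** Let `N ⊴ G` be open of index `2` and
`f : G → M` a crossed homomorphism vanishing on `N`. If every `N`-invariant `a ∈ M` on which the
elements of `G ∖ N` act by `−1` satisfies `s • a = 0` for some odd `s`, then the inflated class `[f]`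
is `0` in `H¹_cont(G, M)`: with `g₀ ∉ N`, `a := f g₀` is `N`-invariant and `g₀ • a = −a` (cocycle
identity at `g₀² ∈ N`), and for `s = 2j + 1` one has `f = ∂(j • a)`.
[cite: SerreGaloisCohomology1997, I.§2.4 and I.§5.8] [cite: SilvermanAEC2009, App. B (B.2.4)] -/
theorem inflClass_eq_zero_of_index_two (N : Subgroup G) [N.Normal] (hN : IsOpen (N : Set G))
    (h2 : N.index = 2) (f : cocyclesVanishingOn M N)
    (hodd : ∀ a : M, (∀ n ∈ N, n • a = a) → (∀ g : G, g ∉ N → g • a = -a) →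
      ∃ s : ℕ, Odd s ∧ s • a = 0) :
    inflClass M N hN f = 0 := by
  -- an element outside `N`
  obtain ⟨g₀, hg₀⟩ : ∃ g₀ : G, g₀ ∉ N := by
    by_contra h
    push Not at h
    have htop : N = ⊤ := (Subgroup.eq_top_iff' N).mpr h
    rw [htop, Subgroup.index_top] at h2
    exact absurd h2 (by decide)
  set a : M := f.1 g₀ with ha
  have haN : ∀ n ∈ N, n • a = a := fun n hn => cocyclesVanishingOn.smul_apply f g₀ hn
  have hg₀sq : g₀ * g₀ ∈ N := (Subgroup.mul_mem_iff_of_index_two h2).mpr (iff_of_false hg₀ hg₀)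
  have hg₀a : g₀ • a = -a := by
    have h := cocyclesVanishingOn.cocycle f g₀ g₀
    rw [cocyclesVanishingOn.apply_of_mem f hg₀sq] at h
    exact eq_neg_of_add_eq_zero_right h.symm
  have hmemN : ∀ g : G, g ∉ N → g₀⁻¹ * g ∈ N := fun g hg =>
    (Subgroup.mul_mem_iff_of_index_two h2).mpr (iff_of_false (fun h => hg₀ (by simpa using h)) hg)
  have hga : ∀ g : G, g ∉ N → g • a = -a := by
    intro g hg
    have e : g = g₀ * (g₀⁻¹ * g) := by group
    rw [e, mul_smul, haN _ (hmemN g hg), hg₀a]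
  obtain ⟨s, ⟨j, rfl⟩, hsa⟩ := hodd a haN hga
  -- `(2j) • a = -a`
  have h2j : (2 * j) • a = -a := by
    rw [succ_nsmul] at hsa
    exact eq_neg_of_add_eq_zero_left hsa
  have hjj : j • a + j • a = -a := by rw [← h2j, two_mul, add_nsmul]
  -- `f = ∂ (j • a)`
  rw [inflClass_apply, Literature.NumberTheory.GaloisRepresentations.oneCocycleClass_eq_zero_iff]
  refine ⟨j • a, fun g => ?_⟩
  rw [discreteTopRep_ρ_apply, toContOneCocycle_apply]
  have hsm : g • (j • a) = j • (g • a) := smul_comm g j a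
  by_cases hg : g ∈ N
  · rw [cocyclesVanishingOn.apply_of_mem f hg, hsm, haN g hg, sub_self]
  · have hfg : f.1 g = a := by
      have e : g = g₀ * (g₀⁻¹ * g) := by group
      rw [e, cocyclesVanishingOn.apply_mul_of_mem f g₀ (hmemN g hg)]
    rw [hfg, hsm, hga g hg, smul_neg]
    have : -(j • a) - j • a = -(j • a + j • a) := by abel
    rw [this, hjj, neg_neg]

end IndexTwo

/-! ## §2 `Ш(E/K) → Ш(E_L/L)` is injective when `[L̃ : K] = 2` and the anti-invariant points are odd torsion -/

section Sha

variable {K : Type u} [Field K] [NumberField K] (W : WeierstrassCurve K)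
variable (L : Type u) [Field L] [NumberField L] [Algebra K L]

/-- **Clean descent at `2` along a quadratic extension.** Let `E/K` be an elliptic curve over a
number field and `L/K` a finite extension whose Galois closure `L̃ ⊆ K̄` has `[Γ_K : Γ_{L̃}] = 2`
(`L/K` quadratic). If every geometric point `P ∈ E(K̄)` fixed by `Γ_{L̃}` (i.e. `P ∈ E(L̃)`) on which
the automorphisms outside `Γ_{L̃}` act by `−1` is killed by an odd integer, then the restriction
`Ш(E/K) → Ш(E_L/L)` is INJECTIVE: its kernel lies in the kernel of `H¹(K, E) → H¹(L, E)`
(`mem_ker_resBaseChange_iff`), which is inflated from `Γ_K/Γ_{L̃}` (`resKer_le_range_inflClass`), and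
such inflated classes vanish by `inflClass_eq_zero_of_index_two`. For `E = E_p`, `K = ℚ`, `L = K′`
a Heegner field: the anti-invariants are `E_p^{(d_{K′})}(ℚ)` (finite, rank-zero twin) and
`E_p(K′)[2] = 0`, so no power of `2` is lost in `Ш(E_p/ℚ) ↪ Ш(E_p/K′)` — the `p`-odd descent step of
Gross 1991 §2 has an exact substitute at `2` on 𝒞_HSY.
[cite: SerreGaloisCohomology1997, I.§5.8] [cite: Darmon2004, §3.9 and Exercise 3.18]
[cite: GrossLMS1991, §2] -/
theorem shaRestriction_injective_of_index_two
    (h2 : (galSubgroupClosure (K := K) L).index = 2)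
    (hodd : ∀ P : WeierstrassCurve.geomPoints W,
      (∀ τ ∈ galSubgroupClosure (K := K) L, τ • P = P) →
      (∀ g : Field.absoluteGaloisGroup K, g ∉ galSubgroupClosure (K := K) L → g • P = -P) →
      ∃ s : ℕ, Odd s ∧ s • P = 0) :
    Function.Injective (shaRestriction W L) := by
  rw [injective_iff_map_eq_zero]
  intro c hc
  have hc' : (c : W.galH1) ∈ W.localRestrictionKer L :=
    (mem_ker_resBaseChange_iff W L c).mp (congrArg Subtype.val hc)
  obtain ⟨f, hf⟩ := resKer_le_range_inflClass (resGal (K := K) L) (pointsMap W L)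
    (pointsMap_smul W L) (pointsMapOfEmb_bijective L W _) (galSubgroupClosure (K := K) L)
    (isOpen_galSubgroupClosure L) (galSubgroupClosure_le_range_resGal L) hc'
  have h0 := inflClass_eq_zero_of_index_two (galSubgroupClosure (K := K) L)
    (isOpen_galSubgroupClosure L) h2 f hodd
  apply Subtype.ext
  change (c : W.galH1) = 0
  rw [← hf, h0]

end Sha

end Summit.BirchSwinnertonDyer.BirchSwinnertonDyer.Theorems.SylvesterTwoUpper

end
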